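import Summits.HubbardSuperconductivity.HubbardSuperconductivity.Theorems.BalabanIRBirEveryGroundStateSchur
import Literature.MathematicalPhysics.QuantumLattice.LTQOProofs
import HarnessLib

/-!
# Crux `JmPairBridge` (stmt-HubbardSuperconductivity-2226), line `schur-rigid-bridge`:
# stub `stub_floorTransport` — irreducibility transports along the floor compression

Route `JosephsonMirror`, crux `JmPairBridge`, line `schur-rigid-bridge`. ABSTRACT finite-dimensional
linear algebra: two subspaces `F₀`, `F₁` of `ι → ℂ` (the ground floor of the sector Hamiltonian at a
non-exceptional coupling and the floor at a nearby coupling) of equal dimension, and a family `S` of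
unitaries preserving both. If the orthogonal compression `F₁ → F₀`, `v ↦ P₀ v` (`P₀` the orthogonal
projection onto `F₀`) is injective — stated as: a vector of `F₁` orthogonal to `F₀` vanishes — then it
is a linear bijection `F₁ → F₀` (injective between spaces of equal dimension) intertwining the action
of `S` (`P₀ X = X P₀`, because `X` and `Xᴴ = X⁻¹` preserve `F₀`; `projMatrix_map_mulVec_comm`). Hence
`S`-irreducibility of `F₁` implies `S`-irreducibility of `F₀`: an `S`-invariant `K' ≤ F₀` pulls back to
the `S`-invariant subspace `F₁ ⊓ P₀⁻¹ K' ≤ F₁`, which is `⊥` or `F₁`, whence `K' = ⊥` or `K' = F₀` by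
surjectivity of the compression.

Sources: J.-P. Serre, *Linear Representations of Finite Groups* §§1.3, 2.2. Folklore; no definition,
no named fact.
-/

noncomputable section

-- the mandated namespace `Summit.<Summit>.<Problem>.Theorems` repeats `HubbardSuperconductivity`
-- (single-problem summit, D-0017), which the `dupNamespace` linter flags on every declaration
set_option linter.dupNamespace false

namespace Summit.HubbardSuperconductivity.HubbardSuperconductivity.Theorems.JosephsonMirror

open Matrix Literature.MathematicalPhysics.QuantumLattice

/-- A unitary matrix (`Xᴴ X = 1`) mapping a subspace `V` of the finite-dimensional space `ι → ℂ` into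
itself restricts to a bijection of `V` (injective, hence surjective by the dimension count), so its
adjoint `Xᴴ = X⁻¹` maps `V` into itself as well: `Xᴴ (X u) = u`.
Serre, *Linear Representations of Finite Groups* §1.3. [folklore] -/
private theorem floorTransport_conjTranspose_mulVec_mem {ι : Type*} [Fintype ι] [DecidableEq ι]
    (V : Submodule ℂ (ι → ℂ)) {X : Matrix ι ι ℂ} (hX : Xᴴ * X = 1)
    (hXV : ∀ v ∈ V, X *ᵥ v ∈ V) : ∀ v ∈ V, Xᴴ *ᵥ v ∈ V := by
  -- adapted from `JosephsonMirrorJmPairBridgeEveryFromSomeTorus.conjTranspose_mulVec_mem_of_unitary`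
  -- the restriction of `X` to `V`
  let f : Module.End ℂ V := (Matrix.toLin' X).restrict (p := V) (q := V) fun v hv => hXV v hv
  have hf : ∀ u : V, ((f u : V) : ι → ℂ) = X *ᵥ (u : ι → ℂ) := fun u => by
    simp [f, LinearMap.restrict_apply]
  have hinj : Function.Injective f := by
    intro u w huw
    apply Subtype.ext
    have h := congrArg (fun z : V => Xᴴ *ᵥ ((z : V) : ι → ℂ)) huw
    simp only [hf, mulVec_mulVec, hX, one_mulVec] at h
    exact h
  intro v hv
  obtain ⟨u, hu⟩ := (LinearMap.injective_iff_surjective.mp hinj) ⟨v, hv⟩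
  have hu' : X *ᵥ (u : ι → ℂ) = v := by
    have h := congrArg Subtype.val hu
    rwa [hf] at h
  rw [← hu', mulVec_mulVec, hX, one_mulVec]
  exact u.2

/-- **STUB `stub_floorTransport`** (abstract; irreducibility transports along the floor compression).
`F₀`, `F₁` two subspaces of `ι → ℂ` of equal dimension, `S` a family of unitaries preserving both. If
every vector of `F₁` orthogonal to `F₀` vanishes (the compression `v ↦ P₀ v`, `P₀` the orthogonal
projection onto `F₀`, is injective on `F₁`, hence bijective `F₁ → F₀` and `S`-equivariant), then
`S`-irreducibility of `F₁` (no `S`-invariant subspace other than `⊥` and `F₁`) implies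
`S`-irreducibility of `F₀`. Serre, *Linear Representations of Finite Groups* §§1.3, 2.2. [folklore] -/
theorem stub_floorTransport {ι : Type*} [Fintype ι] [DecidableEq ι] (F₀ F₁ : Submodule ℂ (ι → ℂ))
    (S : Set (Matrix ι ι ℂ)) (hSU : ∀ X ∈ S, Xᴴ * X = 1)
    (hS₀ : ∀ X ∈ S, ∀ v ∈ F₀, X *ᵥ v ∈ F₀) (hS₁ : ∀ X ∈ S, ∀ v ∈ F₁, X *ᵥ v ∈ F₁)
    (hdim : Module.finrank ℂ ↥F₁ = Module.finrank ℂ ↥F₀)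
    (hinj : ∀ v ∈ F₁, (∀ w ∈ F₀, star w ⬝ᵥ v = 0) → v = 0)
    (hirr : ∀ K' : Submodule ℂ (ι → ℂ), K' ≤ F₁ → (∀ X ∈ S, ∀ v ∈ K', X *ᵥ v ∈ K') →
      K' = ⊥ ∨ K' = F₁) :
    ∀ K' : Submodule ℂ (ι → ℂ), K' ≤ F₀ → (∀ X ∈ S, ∀ v ∈ K', X *ᵥ v ∈ K') →
      K' = ⊥ ∨ K' = F₀ := by
  -- the orthogonal projection onto `F₀` and its elementary algebra
  set P : Matrix ι ι ℂ := projMatrix (F₀.map ((WithLp.linearEquiv 2 ℂ (ι → ℂ)).symm :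
      (ι → ℂ) →ₗ[ℂ] EuclideanSpace ℂ ι)) with hP
  have hPH : P.IsHermitian := projMatrix_isHermitian _
  have hPmem : ∀ x, P *ᵥ x ∈ F₀ := fun x => projMatrix_map_mulVec_mem F₀ x
  have hPfix : ∀ x ∈ F₀, P *ᵥ x = x := fun x hx => projMatrix_map_mulVec_of_mem F₀ hx
  -- adjoints of the symmetries preserve `F₀`, so the symmetries commute with `P`
  have hS₀' : ∀ X ∈ S, ∀ v ∈ F₀, Xᴴ *ᵥ v ∈ F₀ := fun X hX =>
    floorTransport_conjTranspose_mulVec_mem F₀ (hSU X hX) (hS₀ X hX)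
  have hPX : ∀ X ∈ S, ∀ v, P *ᵥ (X *ᵥ v) = X *ᵥ (P *ᵥ v) := fun X hX v =>
    projMatrix_map_mulVec_comm F₀ (hS₀ X hX) (hS₀' X hX) v
  -- the compression `π : F₁ → F₀`, `v ↦ P v`
  let π : F₁ →ₗ[ℂ] F₀ :=
    LinearMap.codRestrict F₀ ((Matrix.toLin' P).domRestrict F₁) fun x => hPmem _
  have hπ : ∀ v : F₁, ((π v : F₀) : ι → ℂ) = P *ᵥ (v : ι → ℂ) := fun v => rfl
  -- `π` is injective: `P v = 0` makes `v ∈ F₁` orthogonal to `F₀`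
  have hπinj : Function.Injective π := by
    refine (injective_iff_map_eq_zero π).2 fun v hv => ?_
    have hPv : P *ᵥ (v : ι → ℂ) = 0 := by
      have h := congrArg Subtype.val hv
      rwa [hπ] at h
    apply Subtype.ext
    refine hinj _ v.2 fun w hw => ?_
    calc star w ⬝ᵥ (v : ι → ℂ) = star (P *ᵥ w) ⬝ᵥ (v : ι → ℂ) := by rw [hPfix w hw]
      _ = star w ⬝ᵥ (P *ᵥ (v : ι → ℂ)) := star_mulVec_dotProduct_of_isHermitian hPH _ _
      _ = 0 := by rw [hPv, dotProduct_zero]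
  -- hence bijective, the dimensions being equal
  have hπsurj : Function.Surjective π :=
    (LinearMap.injective_iff_surjective_of_finrank_eq_finrank hdim).1 hπinj
  have hsurj : ∀ f ∈ F₀, ∃ v ∈ F₁, P *ᵥ v = f := by
    intro f hf
    obtain ⟨v, hv⟩ := hπsurj ⟨f, hf⟩
    refine ⟨v, v.2, ?_⟩
    have h := congrArg Subtype.val hv
    rwa [hπ] at h
  -- pull an `S`-invariant `K' ≤ F₀` back to `F₁` along the compression
  intro K' hK' hK'S
  let K₁ : Submodule ℂ (ι → ℂ) := F₁ ⊓ K'.comap (Matrix.toLin' P)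
  have hmemK₁ : ∀ v, v ∈ K₁ ↔ v ∈ F₁ ∧ P *ᵥ v ∈ K' := fun v => by
    simp only [K₁, Submodule.mem_inf, Submodule.mem_comap, Matrix.toLin'_apply]
  have hK₁le : K₁ ≤ F₁ := inf_le_left
  have hK₁S : ∀ X ∈ S, ∀ v ∈ K₁, X *ᵥ v ∈ K₁ := by
    intro X hX v hv
    rw [hmemK₁] at hv ⊢
    refine ⟨hS₁ X hX v hv.1, ?_⟩
    rw [hPX X hX]
    exact hK'S X hX _ hv.2
  rcases hirr K₁ hK₁le hK₁S with h | h
  · -- `K₁ = ⊥`: every `k ∈ K'` is `P v` with `v ∈ K₁ = ⊥`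
    left
    rw [Submodule.eq_bot_iff] at h ⊢
    intro k hk
    obtain ⟨v, hv₁, hvk⟩ := hsurj k (hK' hk)
    have hvK₁ : v ∈ K₁ := (hmemK₁ v).2 ⟨hv₁, by rw [hvk]; exact hk⟩
    rw [← hvk, h v hvK₁, mulVec_zero]
  · -- `K₁ = F₁`: every `f ∈ F₀` is `P v` with `v ∈ F₁ = K₁`, so `f ∈ K'`
    right
    refine le_antisymm hK' fun f hf => ?_
    obtain ⟨v, hv₁, hvf⟩ := hsurj f hf
    rw [← hvf]
    exact ((hmemK₁ v).1 (h.ge hv₁)).2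

end Summit.HubbardSuperconductivity.HubbardSuperconductivity.Theorems.JosephsonMirror

end
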